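import Literature.NumberTheory.Automorphic.UnitaryGroupCharpolyClassMap
import Mathlib.LinearAlgebra.Lagrange
import Mathlib.Topology.Instances.Matrix
import HarnessLib

/-!
# Only finitely many characteristic-polynomial classes of `G(F)` meet a compact subset of `G(𝔸_F)`
(Rogawski, *Automorphic Representations of Unitary Groups in Three Variables* (1990), §2.2 p. 13
«the sums over `δ` and `γ` in the definitions of `k^T(x)` and `K_P(x, y)` are finite»; Arthur,
*A trace formula for reductive groups I*, Duke Math. J. 45 (1978), §5: only finitely many classes `𝔬`
meet a compact set; Gelbart (1975), (9.20) «the sum is actually finite»)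

Topic `NumberTheory/Automorphic`; namespace `Literature.NumberTheory.Automorphic.UnitaryGroup`. THEOREMS
ONLY over accepted tree modules: no definition, no named fact, no `sorry`, no instance, no notation.
Brick (C9) of the T1-qs LAW 3 road («the `𝔬`-expansion `J^T(f) = Σ_𝔬 J^T_𝔬(f)`», ★
`UnitaryGroupArthurKernelClassExpansion`) for the characteristic-polynomial class map of ★
`UnitaryGroupCharpolyClassMap`: the set of classes `charpoly (adelicVal γ)` of rational elements
`γ ∈ G(F)` having a `G(𝔸_F)`-conjugate `x⁻¹ γ x` in a compact `C` is FINITE — the finite index set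
`S_f` of `J^T(f) = Σ_{𝔬 ∈ S_f} J^T_𝔬(f)` and of the class decompositions `K = Σ_{𝔬 ∈ S} K_𝔬`
(★ `kernel_eq_sum_kernelClass_of_finite`). Route WITHOUT coefficient continuity:

* §1 `charpoly_adelicVal_conj`: `charpoly (adelicVal (x⁻¹ γ x)) = charpoly (adelicVal γ)` for every
  `x ∈ G(𝔸_F)` (Mathlib `Matrix.charpoly_units_conj'` in `GL_N(𝔸_E)`); `eval_charpoly_adelicVal`:
  `(charpoly (adelicVal g)).eval t = det (t • 1 − adelicVal g)` (Mathlib `Matrix.eval_charpoly`), continuous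
  in `g`.
* §2 EVALUATION VECTORS: for a rational element the values of its adelic characteristic polynomial at
  the principal points `0, 1, …, N−1` are PRINCIPAL adeles (★ `charpoly_adelicVal_toAdelic`,
  `Polynomial.eval₂_at_apply`); two monic degree-`N` polynomials over `E` with the same values there are
  equal (Mathlib `Polynomial.eq_of_degree_le_of_eval_finset_eq`, characteristic `0`).
* §3 **`finite_image_charpoly_of_isCompact`** — the evaluation vector maps the set of classes meeting `C`
  injectively into `∏_{j<N} (K_j ∩ E)`, `K_j` the compact image of `C` under `g ↦ det (j • 1 − adelicVal g)`,
  and a compact set meets the discrete closed subgroup `E ⊂ 𝔸_E` (★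
  `AdeleRing.discreteTopology_principalSubgroup`) in a finite set.

## References

* J. D. Rogawski, *Automorphic Representations of Unitary Groups in Three Variables*, Annals of
  Mathematics Studies 123 (1990), §2.2 (p. 13) [Rogawski1990].
* J. Arthur, *A trace formula for reductive groups I: terms associated to classes in `G(ℚ)`*, Duke
  Math. J. 45 (1978), §5 [Arthur1978TraceFormulaI].
* S. Gelbart, *Automorphic forms on adele groups*, Annals of Mathematics Studies 83 (1975), §9.B (9.20)
  [Gelbart1975].
-/

set_option autoImplicit false

noncomputable section

open NumberField IsDedekindDomain Matrix Polynomial Topology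
open scoped Classical

namespace Literature.NumberTheory.Automorphic

namespace UnitaryGroup

variable {F E : Type} [Field F] [NumberField F] [Field E] [NumberField E] [Algebra F E]
  {c : E ≃ₐ[F] E} {N : ℕ}

/-! ## §1 Conjugation invariance in `GL_N(𝔸_E)` and the evaluation of the characteristic polynomial -/

/-- **`charpoly (x⁻¹ γ x) = charpoly γ`** for `γ, x ∈ G(𝔸_F)` (Mathlib `Matrix.charpoly_units_conj'` in
`GL_N(𝔸_E)`). [cite: Rogawski1990, §2.2 (p. 13)] -/
theorem charpoly_adelicVal_conj (γ x : (quasiSplit F E c N).Adelic) :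
    ((adelicVal F E c N _ (x⁻¹ * γ * x) : GL (Fin N) (AdeleRing (𝓞 E) E)) :
        Matrix (Fin N) (Fin N) (AdeleRing (𝓞 E) E)).charpoly =
      ((adelicVal F E c N _ γ : GL (Fin N) (AdeleRing (𝓞 E) E)) :
        Matrix (Fin N) (Fin N) (AdeleRing (𝓞 E) E)).charpoly := by
  simp only [map_mul, map_inv, Units.val_mul]
  rw [Matrix.coe_units_inv]
  exact Matrix.charpoly_units_conj' _ _

/-- `(charpoly (adelicVal g)).eval t = det (scalar t − adelicVal g)` (Mathlib `Matrix.eval_charpoly`).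
[folklore] -/
private theorem eval_charpoly_adelicVal (g : (quasiSplit F E c N).Adelic) (t : AdeleRing (𝓞 E) E) :
    ((adelicVal F E c N _ g : GL (Fin N) (AdeleRing (𝓞 E) E)) :
        Matrix (Fin N) (Fin N) (AdeleRing (𝓞 E) E)).charpoly.eval t =
      (Matrix.scalar (Fin N) t - ((adelicVal F E c N _ g : GL (Fin N) (AdeleRing (𝓞 E) E)) :
        Matrix (Fin N) (Fin N) (AdeleRing (𝓞 E) E))).det :=
  Matrix.eval_charpoly _ t

/-- `g ↦ det (scalar t − adelicVal g)` is continuous on `G(𝔸_F)`. [folklore] -/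
private theorem continuous_det_scalar_sub_adelicVal (t : AdeleRing (𝓞 E) E) :
    Continuous fun g : (quasiSplit F E c N).Adelic =>
      (Matrix.scalar (Fin N) t - ((adelicVal F E c N _ g : GL (Fin N) (AdeleRing (𝓞 E) E)) :
        Matrix (Fin N) (Fin N) (AdeleRing (𝓞 E) E))).det := by
  have hmat : Continuous fun g : (quasiSplit F E c N).Adelic =>
      ((adelicVal F E c N _ g : GL (Fin N) (AdeleRing (𝓞 E) E)) : Matrix (Fin N) (Fin N) (AdeleRing (𝓞 E) E)) :=
    Units.continuous_val.comp continuous_subtype_val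
  exact (continuous_const.sub hmat).matrix_det

/-! ## §2 Rational elements: principal evaluation vectors, and monic uniqueness over `E` -/

/-- For a rational element `γ = ι(γ₀)` and a rational scalar `a`, the value of the adelic characteristic
polynomial at `ι_E(a)` is the PRINCIPAL adele `ι_E ((charpoly γ₀).eval a)`
(★ `charpoly_adelicVal_toAdelic`, `Polynomial.eval₂_at_apply`). [cite: Rogawski1990, §2.2 (p. 13)] -/
theorem eval_charpoly_adelicVal_toAdelic (γ₀ : (quasiSplit F E c N).Rational) (a : E) :
    ((adelicVal F E c N _ ((quasiSplit F E c N).toAdelic γ₀) : GL (Fin N) (AdeleRing (𝓞 E) E)) :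
        Matrix (Fin N) (Fin N) (AdeleRing (𝓞 E) E)).charpoly.eval (algebraMap E (AdeleRing (𝓞 E) E) a) =
      algebraMap E (AdeleRing (𝓞 E) E) (((γ₀.val : GL (Fin N) E) : Matrix (Fin N) (Fin N) E).charpoly.eval a) := by
  rw [charpoly_adelicVal_toAdelic, Polynomial.eval_map, Polynomial.eval₂_at_apply]

/-- **Two rational characteristic polynomials with the same values at `0, 1, …, N−1` are equal**: both
are monic of degree `N` (Mathlib `Matrix.charpoly_monic`, `charpoly_natDegree_eq_dim`) and `E` has
characteristic `0` (Mathlib `Polynomial.eq_of_degree_le_of_eval_finset_eq`). [folklore] -/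
private theorem charpoly_eq_of_forall_eval_natCast_eq (A B : Matrix (Fin N) (Fin N) E)
    (h : ∀ j : Fin N, A.charpoly.eval ((j : ℕ) : E) = B.charpoly.eval ((j : ℕ) : E)) :
    A.charpoly = B.charpoly := by
  set s : Finset E := Finset.univ.image (fun j : Fin N => ((j : ℕ) : E)) with hs
  have hcard : s.card = N := by
    rw [hs, Finset.card_image_of_injective _ (fun a b hab => Fin.ext (Nat.cast_injective hab)),
      Finset.card_univ, Fintype.card_fin]
  refine Polynomial.eq_of_degree_le_of_eval_finset_eq s ?_ ?_ ?_ ?_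
  · rw [hcard, Polynomial.degree_eq_natDegree (Matrix.charpoly_monic A).ne_zero,
      Matrix.charpoly_natDegree_eq_dim, Fintype.card_fin]
  · rw [Polynomial.degree_eq_natDegree (Matrix.charpoly_monic A).ne_zero,
      Polynomial.degree_eq_natDegree (Matrix.charpoly_monic B).ne_zero,
      Matrix.charpoly_natDegree_eq_dim, Matrix.charpoly_natDegree_eq_dim]
  · rw [(Matrix.charpoly_monic A).leadingCoeff, (Matrix.charpoly_monic B).leadingCoeff]
  · intro x hx
    obtain ⟨j, -, rfl⟩ := Finset.mem_image.1 hx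
    exact h j

/-! ## §3 Finiteness -/

omit [NumberField F] [Algebra F E] in
/-- `𝔸_E` is Hausdorff (local copy of the standard three-line argument). [folklore] -/
private theorem t2Space_adeleRing_E₁₃ : T2Space (AdeleRing (𝓞 E) E) := by
  haveI : T2Space (FiniteAdeleRing (𝓞 E) E) := inferInstanceAs <| T2Space
    (RestrictedProduct (fun w : HeightOneSpectrum (𝓞 E) => w.adicCompletion E)
      (fun w => (w.adicCompletionIntegers E : Set (w.adicCompletion E))) Filter.cofinite)
  haveI : T2Space (InfiniteAdeleRing E) :=
    inferInstanceAs <| T2Space ((w : InfinitePlace E) → w.Completion)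
  exact inferInstanceAs <| T2Space (InfiniteAdeleRing E × FiniteAdeleRing (𝓞 E) E)

omit [NumberField F] [Algebra F E] in
/-- A compact subset of `𝔸_E` contains only finitely many principal adeles: `E` is a discrete
(★ `AdeleRing.discreteTopology_principalSubgroup`), hence closed, subgroup of `𝔸_E`. [cite: Gelbart1975, (9.20)] -/
private theorem finite_inter_principalSubgroup {K : Set (AdeleRing (𝓞 E) E)} (hK : IsCompact K) :
    (K ∩ (AdeleRing.principalSubgroup (𝓞 E) E : Set (AdeleRing (𝓞 E) E))).Finite := by
  haveI := AdeleRing.discreteTopology_principalSubgroup E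
  haveI := t2Space_adeleRing_E₁₃ (E := E)
  have hP : IsClosed (AdeleRing.principalSubgroup (𝓞 E) E : Set (AdeleRing (𝓞 E) E)) :=
    AddSubgroup.isClosed_of_discrete
  have hKD : IsCompact (K ∩ (AdeleRing.principalSubgroup (𝓞 E) E : Set (AdeleRing (𝓞 E) E))) :=
    hK.inter_right hP
  exact hKD.finite (isDiscrete_iff_discreteTopology.mpr
    (DiscreteTopology.of_subset ‹DiscreteTopology (AdeleRing.principalSubgroup (𝓞 E) E)›
      Set.inter_subset_right))

/-- **ONLY FINITELY MANY CHARACTERISTIC-POLYNOMIAL CLASSES MEET A COMPACT SET.** For a compact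
`C ⊆ G(𝔸_F) = U(J_N)(𝔸_F)`, the set of polynomials `charpoly (adelicVal γ)`, `γ ∈ G(F)` with some conjugate
`x⁻¹ γ x ∈ C` (`x ∈ G(𝔸_F)`), is finite. Proof: the evaluation vector
`V p = (p.eval (ι_E j))_{j < N}` lies in `∏_j K_j`, `K_j` the compact image of `C` under
`g ↦ det (ι_E j • 1 − adelicVal g)` (§1: `charpoly (adelicVal γ) = charpoly (adelicVal (x⁻¹ γ x))`,
Mathlib `Matrix.eval_charpoly`), and has PRINCIPAL entries (§2), so it ranges in the finite set
`∏_j (K_j ∩ E)`; and `V` is injective on these polynomials, two monic degree-`N` rational characteristic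
polynomials with the same values at `0, …, N−1` being equal (§2). This is the finite index set of the
`𝔬`-expansion `J^T(f) = Σ_{𝔬 ∈ S_f} J^T_𝔬(f)` for the class map of ★ `UnitaryGroupCharpolyClassMap`
(Rogawski (1990), §2.2 «the sums … are finite»; Arthur (1978), §5). [cite: Rogawski1990, §2.2 (p. 13)]
[cite: Arthur1978TraceFormulaI, §5] -/
theorem finite_image_charpoly_of_isCompact {C : Set (quasiSplit F E c N).Adelic} (hC : IsCompact C) :
    {p : (AdeleRing (𝓞 E) E)[X] | ∃ γ : (quasiSplit F E c N).arithmeticSubgroup,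
        ∃ x : (quasiSplit F E c N).Adelic,
          x⁻¹ * (γ : (quasiSplit F E c N).Adelic) * x ∈ C ∧
          ((adelicVal F E c N _ (γ : (quasiSplit F E c N).Adelic) : GL (Fin N) (AdeleRing (𝓞 E) E)) :
            Matrix (Fin N) (Fin N) (AdeleRing (𝓞 E) E)).charpoly = p}.Finite := by
  -- the evaluation vector at the principal points `0, …, N−1`
  set ιE : E →+* AdeleRing (𝓞 E) E := algebraMap E (AdeleRing (𝓞 E) E) with hιE
  set V : (AdeleRing (𝓞 E) E)[X] → (Fin N → AdeleRing (𝓞 E) E) :=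
    fun p j => p.eval (ιE ((j : ℕ) : E)) with hV
  -- the compact pieces `K_j` and the finite target
  set K : Fin N → Set (AdeleRing (𝓞 E) E) := fun j =>
    (fun g : (quasiSplit F E c N).Adelic =>
      (Matrix.scalar (Fin N) (ιE ((j : ℕ) : E)) -
        ((adelicVal F E c N _ g : GL (Fin N) (AdeleRing (𝓞 E) E)) :
          Matrix (Fin N) (Fin N) (AdeleRing (𝓞 E) E))).det) '' C with hK
  have hKc : ∀ j, IsCompact (K j) := fun j => hC.image (continuous_det_scalar_sub_adelicVal _)
  have hTfin : (Set.pi Set.univ fun j : Fin N =>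
      K j ∩ (AdeleRing.principalSubgroup (𝓞 E) E : Set (AdeleRing (𝓞 E) E))).Finite :=
    Set.Finite.pi fun j => finite_inter_principalSubgroup (hKc j)
  set S : Set (AdeleRing (𝓞 E) E)[X] := {p : (AdeleRing (𝓞 E) E)[X] |
      ∃ γ : (quasiSplit F E c N).arithmeticSubgroup, ∃ x : (quasiSplit F E c N).Adelic,
        x⁻¹ * (γ : (quasiSplit F E c N).Adelic) * x ∈ C ∧
        ((adelicVal F E c N _ (γ : (quasiSplit F E c N).Adelic) : GL (Fin N) (AdeleRing (𝓞 E) E)) :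
          Matrix (Fin N) (Fin N) (AdeleRing (𝓞 E) E)).charpoly = p} with hS
  -- `V` maps `S` into the finite target
  have hmaps : V '' S ⊆ Set.pi Set.univ fun j : Fin N =>
      K j ∩ (AdeleRing.principalSubgroup (𝓞 E) E : Set (AdeleRing (𝓞 E) E)) := by
    rintro _ ⟨p, ⟨γ, x, hxC, rfl⟩, rfl⟩
    obtain ⟨γ₀, hγ₀⟩ := γ.2
    refine fun j _ => ⟨?_, ?_⟩
    · -- `V p j = det (j − adelicVal (x⁻¹ γ x)) ∈ K_j`
      refine ⟨x⁻¹ * (γ : (quasiSplit F E c N).Adelic) * x, hxC, ?_⟩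
      change _ = (((adelicVal F E c N _ (γ : (quasiSplit F E c N).Adelic) : GL (Fin N) (AdeleRing (𝓞 E) E)) :
        Matrix (Fin N) (Fin N) (AdeleRing (𝓞 E) E)).charpoly).eval (ιE ((j : ℕ) : E))
      rw [← charpoly_adelicVal_conj (γ : (quasiSplit F E c N).Adelic) x, eval_charpoly_adelicVal]
    · -- `V p j` is principal
      change (((adelicVal F E c N _ (γ : (quasiSplit F E c N).Adelic) : GL (Fin N) (AdeleRing (𝓞 E) E)) :
        Matrix (Fin N) (Fin N) (AdeleRing (𝓞 E) E)).charpoly).eval (ιE ((j : ℕ) : E)) ∈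
          (AdeleRing.principalSubgroup (𝓞 E) E : Set (AdeleRing (𝓞 E) E))
      rw [← hγ₀]
      change (((adelicVal F E c N _ ((quasiSplit F E c N).toAdelic γ₀) : GL (Fin N) (AdeleRing (𝓞 E) E)) :
        Matrix (Fin N) (Fin N) (AdeleRing (𝓞 E) E)).charpoly).eval (algebraMap E (AdeleRing (𝓞 E) E) ((j : ℕ) : E)) ∈
          (AdeleRing.principalSubgroup (𝓞 E) E : Set (AdeleRing (𝓞 E) E))
      rw [eval_charpoly_adelicVal_toAdelic]
      exact ⟨_, rfl⟩
  -- `V` is injective on `S`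
  have hinj : Set.InjOn V S := by
    rintro p ⟨γ, x, -, rfl⟩ p' ⟨γ', x', -, rfl⟩ hVV
    obtain ⟨γ₀, hγ₀⟩ := γ.2
    obtain ⟨γ₀', hγ₀'⟩ := γ'.2
    have hp : ((adelicVal F E c N _ (γ : (quasiSplit F E c N).Adelic) : GL (Fin N) (AdeleRing (𝓞 E) E)) :
        Matrix (Fin N) (Fin N) (AdeleRing (𝓞 E) E)).charpoly =
        (((γ₀.val : GL (Fin N) E)) : Matrix (Fin N) (Fin N) E).charpoly.map ιE := by
      rw [← hγ₀]; exact charpoly_adelicVal_toAdelic γ₀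
    have hp' : ((adelicVal F E c N _ (γ' : (quasiSplit F E c N).Adelic) : GL (Fin N) (AdeleRing (𝓞 E) E)) :
        Matrix (Fin N) (Fin N) (AdeleRing (𝓞 E) E)).charpoly =
        (((γ₀'.val : GL (Fin N) E)) : Matrix (Fin N) (Fin N) E).charpoly.map ιE := by
      rw [← hγ₀']; exact charpoly_adelicVal_toAdelic γ₀'
    rw [hp, hp']
    congr 1
    refine charpoly_eq_of_forall_eval_natCast_eq _ _ fun j => ?_
    apply AdeleRing.algebraMap_injective (𝓞 E) E
    have hj := congrFun hVV j
    change (((adelicVal F E c N _ (γ : (quasiSplit F E c N).Adelic) : GL (Fin N) (AdeleRing (𝓞 E) E)) :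
        Matrix (Fin N) (Fin N) (AdeleRing (𝓞 E) E)).charpoly).eval (ιE ((j : ℕ) : E)) =
      (((adelicVal F E c N _ (γ' : (quasiSplit F E c N).Adelic) : GL (Fin N) (AdeleRing (𝓞 E) E)) :
        Matrix (Fin N) (Fin N) (AdeleRing (𝓞 E) E)).charpoly).eval (ιE ((j : ℕ) : E)) at hj
    rw [hp, hp', Polynomial.eval_map, Polynomial.eval_map, Polynomial.eval₂_at_apply,
      Polynomial.eval₂_at_apply] at hj
    exact hj
  exact Set.Finite.of_finite_image (hTfin.subset hmaps) hinj

/-! ## §4 (Ed. 2) The Borel-kernel side: adelic unipotent saturation, and the classes read on points of `C`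

In `K_B(y, y) = ν(𝓕)⁻¹ ∫_𝓕 Σ_{β ∈ B(F)} f(y⁻¹ β u y) dν(u)` the element conjugated into `C = tsupport f` is `β u`,
`u ∈ N(𝔸_F)` ADELIC; its class is that of `β` (`charpoly (β u) = charpoly β`), and §3 holds in the form «rational
characteristic polynomials of POINTS OF `C`» (★ `finite_image_charpoly_of_isCompact` is the case `g = x⁻¹ γ x`). -/

/-- **ADELIC `N(𝔸_F)`-SATURATION ON `B(𝔸_F)`**: `charpoly (b u) = charpoly b` for `b ∈ B(𝔸_F)` and
`u ∈ N(𝔸_F)` — `b` is upper triangular (★ `mem_borelAdelic_iff`) and `u` upper unitriangular (★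
`mem_adelicUnipotent_iff`, ★ `mem_upperUnitriangular_iff`), so `b u` is upper triangular with the diagonal of
`b`, and both characteristic polynomials are `∏ᵢ (X − C bᵢᵢ)` (Mathlib `Matrix.charpoly_of_upperTriangular`).
The adelic form of ★ `isUnipotentInvariantOnBorel_charpoly_adelicVal` (Rogawski (1990), §2.2: `K_{P,𝔬}`
integrates over all of `𝐍_P`). [cite: Rogawski1990, §2.2 (p. 13)] -/
theorem charpoly_adelicVal_mul_of_mem_borelAdelic_of_mem_adelicUnipotent {b u : (quasiSplit F E c N).Adelic}
    (hb : b ∈ borelAdelic F E c N) (hu : u ∈ adelicUnipotent F E c N) :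
    ((adelicVal F E c N _ (b * u) : GL (Fin N) (AdeleRing (𝓞 E) E)) :
        Matrix (Fin N) (Fin N) (AdeleRing (𝓞 E) E)).charpoly =
      ((adelicVal F E c N _ b : GL (Fin N) (AdeleRing (𝓞 E) E)) :
        Matrix (Fin N) (Fin N) (AdeleRing (𝓞 E) E)).charpoly := by
  have hB : ((adelicVal F E c N _ b : GL (Fin N) (AdeleRing (𝓞 E) E)) :
      Matrix (Fin N) (Fin N) (AdeleRing (𝓞 E) E)).BlockTriangular id := (mem_borelAdelic_iff _).1 hb
  obtain ⟨hU, hU1⟩ := (mem_upperUnitriangular_iff _).1 ((mem_adelicUnipotent_iff _).1 hu)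
  simp only [map_mul, Units.val_mul]
  rw [Matrix.charpoly_of_upperTriangular _ (hB.mul hU), Matrix.charpoly_of_upperTriangular _ hB]
  refine Finset.prod_congr rfl fun i _ => ?_
  -- the diagonal of `b u` is that of `b`
  have hdiag : (((adelicVal F E c N _ b : GL (Fin N) (AdeleRing (𝓞 E) E)) :
        Matrix (Fin N) (Fin N) (AdeleRing (𝓞 E) E)) *
      ((adelicVal F E c N _ u : GL (Fin N) (AdeleRing (𝓞 E) E)) :
        Matrix (Fin N) (Fin N) (AdeleRing (𝓞 E) E))) i i =
      ((adelicVal F E c N _ b : GL (Fin N) (AdeleRing (𝓞 E) E)) :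
        Matrix (Fin N) (Fin N) (AdeleRing (𝓞 E) E)) i i := by
    rw [Matrix.mul_apply, Finset.sum_eq_single i]
    · rw [hU1 i, mul_one]
    · intro k _ hki
      rcases lt_or_gt_of_ne hki with hlt | hlt
      · rw [hB hlt, zero_mul]
      · rw [hU hlt, mul_zero]
    · exact fun hi => absurd (Finset.mem_univ i) hi
  rw [hdiag]

/-- **ONLY FINITELY MANY RATIONAL CHARACTERISTIC POLYNOMIALS ARE CHARACTERISTIC POLYNOMIALS OF POINTS OF A
COMPACT SET.** For a compact `C ⊆ G(𝔸_F)`, the set of `p ∈ 𝔸_E[X]` which are at once `charpoly (adelicVal γ)`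
for some `γ ∈ G(F)` AND `charpoly (adelicVal g)` for some `g ∈ C` is finite — the proof of ★
`finite_image_charpoly_of_isCompact` with its first step skipped: the evaluation vector
`V p = (p.eval (ι_E j))_{j<N}` has `j`-th entry `det (ι_E j • 1 − adelicVal g) ∈ K_j` (compact) directly from
`g ∈ C`, PRINCIPAL entries from the rational `γ` (§2), so ranges in the finite `∏_j (K_j ∩ E)`, and `V` is
injective on rational characteristic polynomials (§2). This is the finite index set `S_f` of the `𝔬`-expansion
on BOTH sides, `K(x,x) = Σ_γ f(x⁻¹ γ x)` and `K_B(y,y) ∋ f(y⁻¹ β u y)` (with ★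
`charpoly_adelicVal_mul_of_mem_borelAdelic_of_mem_adelicUnipotent`). [cite: Rogawski1990, §2.2 (p. 13)]
[cite: Arthur1978TraceFormulaI, §5] -/
theorem finite_setOf_charpoly_eq_of_isCompact {C : Set (quasiSplit F E c N).Adelic} (hC : IsCompact C) :
    {p : (AdeleRing (𝓞 E) E)[X] |
        (∃ γ : (quasiSplit F E c N).arithmeticSubgroup,
          ((adelicVal F E c N _ (γ : (quasiSplit F E c N).Adelic) : GL (Fin N) (AdeleRing (𝓞 E) E)) :
            Matrix (Fin N) (Fin N) (AdeleRing (𝓞 E) E)).charpoly = p) ∧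
        ∃ g ∈ C, ((adelicVal F E c N _ g : GL (Fin N) (AdeleRing (𝓞 E) E)) :
            Matrix (Fin N) (Fin N) (AdeleRing (𝓞 E) E)).charpoly = p}.Finite := by
  -- the evaluation vector at the principal points `0, …, N−1`
  set ιE : E →+* AdeleRing (𝓞 E) E := algebraMap E (AdeleRing (𝓞 E) E) with hιE
  set V : (AdeleRing (𝓞 E) E)[X] → (Fin N → AdeleRing (𝓞 E) E) :=
    fun p j => p.eval (ιE ((j : ℕ) : E)) with hV
  -- the compact pieces `K_j` and the finite target
  set K : Fin N → Set (AdeleRing (𝓞 E) E) := fun j =>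
    (fun g : (quasiSplit F E c N).Adelic =>
      (Matrix.scalar (Fin N) (ιE ((j : ℕ) : E)) -
        ((adelicVal F E c N _ g : GL (Fin N) (AdeleRing (𝓞 E) E)) :
          Matrix (Fin N) (Fin N) (AdeleRing (𝓞 E) E))).det) '' C with hK
  have hKc : ∀ j, IsCompact (K j) := fun j => hC.image (continuous_det_scalar_sub_adelicVal _)
  have hTfin : (Set.pi Set.univ fun j : Fin N =>
      K j ∩ (AdeleRing.principalSubgroup (𝓞 E) E : Set (AdeleRing (𝓞 E) E))).Finite :=
    Set.Finite.pi fun j => finite_inter_principalSubgroup (hKc j)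
  set S : Set (AdeleRing (𝓞 E) E)[X] := {p : (AdeleRing (𝓞 E) E)[X] |
      (∃ γ : (quasiSplit F E c N).arithmeticSubgroup,
        ((adelicVal F E c N _ (γ : (quasiSplit F E c N).Adelic) : GL (Fin N) (AdeleRing (𝓞 E) E)) :
          Matrix (Fin N) (Fin N) (AdeleRing (𝓞 E) E)).charpoly = p) ∧
      ∃ g ∈ C, ((adelicVal F E c N _ g : GL (Fin N) (AdeleRing (𝓞 E) E)) :
          Matrix (Fin N) (Fin N) (AdeleRing (𝓞 E) E)).charpoly = p} with hS
  -- `V` maps `S` into the finite target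
  have hmaps : V '' S ⊆ Set.pi Set.univ fun j : Fin N =>
      K j ∩ (AdeleRing.principalSubgroup (𝓞 E) E : Set (AdeleRing (𝓞 E) E)) := by
    rintro _ ⟨p, ⟨⟨γ, hγp⟩, g, hgC, rfl⟩, rfl⟩
    obtain ⟨γ₀, hγ₀⟩ := γ.2
    refine fun j _ => ⟨?_, ?_⟩
    · -- `V p j = det (j − adelicVal g) ∈ K_j`
      refine ⟨g, hgC, ?_⟩
      change _ = (((adelicVal F E c N _ g : GL (Fin N) (AdeleRing (𝓞 E) E)) :
        Matrix (Fin N) (Fin N) (AdeleRing (𝓞 E) E)).charpoly).eval (ιE ((j : ℕ) : E))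
      rw [eval_charpoly_adelicVal]
    · -- `V p j` is principal
      change (((adelicVal F E c N _ g : GL (Fin N) (AdeleRing (𝓞 E) E)) :
        Matrix (Fin N) (Fin N) (AdeleRing (𝓞 E) E)).charpoly).eval (ιE ((j : ℕ) : E)) ∈
          (AdeleRing.principalSubgroup (𝓞 E) E : Set (AdeleRing (𝓞 E) E))
      rw [← hγp, ← hγ₀]
      change (((adelicVal F E c N _ ((quasiSplit F E c N).toAdelic γ₀) : GL (Fin N) (AdeleRing (𝓞 E) E)) :
        Matrix (Fin N) (Fin N) (AdeleRing (𝓞 E) E)).charpoly).eval (algebraMap E (AdeleRing (𝓞 E) E) ((j : ℕ) : E)) ∈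
          (AdeleRing.principalSubgroup (𝓞 E) E : Set (AdeleRing (𝓞 E) E))
      rw [eval_charpoly_adelicVal_toAdelic]
      exact ⟨_, rfl⟩
  -- `V` is injective on `S`
  have hinj : Set.InjOn V S := by
    rintro p ⟨⟨γ, rfl⟩, -⟩ p' ⟨⟨γ', rfl⟩, -⟩ hVV
    obtain ⟨γ₀, hγ₀⟩ := γ.2
    obtain ⟨γ₀', hγ₀'⟩ := γ'.2
    have hp : ((adelicVal F E c N _ (γ : (quasiSplit F E c N).Adelic) : GL (Fin N) (AdeleRing (𝓞 E) E)) :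
        Matrix (Fin N) (Fin N) (AdeleRing (𝓞 E) E)).charpoly =
        (((γ₀.val : GL (Fin N) E)) : Matrix (Fin N) (Fin N) E).charpoly.map ιE := by
      rw [← hγ₀]; exact charpoly_adelicVal_toAdelic γ₀
    have hp' : ((adelicVal F E c N _ (γ' : (quasiSplit F E c N).Adelic) : GL (Fin N) (AdeleRing (𝓞 E) E)) :
        Matrix (Fin N) (Fin N) (AdeleRing (𝓞 E) E)).charpoly =
        (((γ₀'.val : GL (Fin N) E)) : Matrix (Fin N) (Fin N) E).charpoly.map ιE := by
      rw [← hγ₀']; exact charpoly_adelicVal_toAdelic γ₀'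
    rw [hp, hp']
    congr 1
    refine charpoly_eq_of_forall_eval_natCast_eq _ _ fun j => ?_
    apply AdeleRing.algebraMap_injective (𝓞 E) E
    have hj := congrFun hVV j
    change (((adelicVal F E c N _ (γ : (quasiSplit F E c N).Adelic) : GL (Fin N) (AdeleRing (𝓞 E) E)) :
        Matrix (Fin N) (Fin N) (AdeleRing (𝓞 E) E)).charpoly).eval (ιE ((j : ℕ) : E)) =
      (((adelicVal F E c N _ (γ' : (quasiSplit F E c N).Adelic) : GL (Fin N) (AdeleRing (𝓞 E) E)) :
        Matrix (Fin N) (Fin N) (AdeleRing (𝓞 E) E)).charpoly).eval (ιE ((j : ℕ) : E)) at hj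
    rw [hp, hp', Polynomial.eval_map, Polynomial.eval_map, Polynomial.eval₂_at_apply,
      Polynomial.eval₂_at_apply] at hj
    exact hj
  exact Set.Finite.of_finite_image (hTfin.subset hmaps) hinj

/-- **The `K`-side membership**: if a conjugate `x⁻¹ γ x` of the rational `γ` lies in `C`, then
`charpoly (adelicVal γ)` is in the finite set of ★ `finite_setOf_charpoly_eq_of_isCompact` (★
`charpoly_adelicVal_conj`). [cite: Rogawski1990, §2.2 (p. 13)] -/
theorem charpoly_adelicVal_mem_setOf_of_conj_mem {C : Set (quasiSplit F E c N).Adelic}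
    {γ : (quasiSplit F E c N).arithmeticSubgroup} {x : (quasiSplit F E c N).Adelic}
    (h : x⁻¹ * (γ : (quasiSplit F E c N).Adelic) * x ∈ C) :
    ((adelicVal F E c N _ (γ : (quasiSplit F E c N).Adelic) : GL (Fin N) (AdeleRing (𝓞 E) E)) :
        Matrix (Fin N) (Fin N) (AdeleRing (𝓞 E) E)).charpoly ∈
      {p : (AdeleRing (𝓞 E) E)[X] |
        (∃ γ : (quasiSplit F E c N).arithmeticSubgroup,
          ((adelicVal F E c N _ (γ : (quasiSplit F E c N).Adelic) : GL (Fin N) (AdeleRing (𝓞 E) E)) :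
            Matrix (Fin N) (Fin N) (AdeleRing (𝓞 E) E)).charpoly = p) ∧
        ∃ g ∈ C, ((adelicVal F E c N _ g : GL (Fin N) (AdeleRing (𝓞 E) E)) :
            Matrix (Fin N) (Fin N) (AdeleRing (𝓞 E) E)).charpoly = p} :=
  ⟨⟨γ, rfl⟩, _, h, charpoly_adelicVal_conj _ _⟩

/-- **The `K_B`-side membership**: if `y⁻¹ (β u) y ∈ C` for a rational Borel `β ∈ B(F)`, an ADELIC unipotent
`u ∈ N(𝔸_F)` and `y ∈ G(𝔸_F)`, then `charpoly (adelicVal β)` is in the finite set of ★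
`finite_setOf_charpoly_eq_of_isCompact` (★ `charpoly_adelicVal_conj` and ★
`charpoly_adelicVal_mul_of_mem_borelAdelic_of_mem_adelicUnipotent`). [cite: Rogawski1990, §2.2 (p. 13)] -/
theorem charpoly_adelicVal_mem_setOf_of_conj_mul_mem {C : Set (quasiSplit F E c N).Adelic}
    {β : (quasiSplit F E c N).arithmeticSubgroup} (hβ : β ∈ arithmeticBorel F E c N)
    {u : (quasiSplit F E c N).Adelic} (hu : u ∈ adelicUnipotent F E c N) {y : (quasiSplit F E c N).Adelic}
    (h : y⁻¹ * (β : (quasiSplit F E c N).Adelic) * (u * y) ∈ C) :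
    ((adelicVal F E c N _ (β : (quasiSplit F E c N).Adelic) : GL (Fin N) (AdeleRing (𝓞 E) E)) :
        Matrix (Fin N) (Fin N) (AdeleRing (𝓞 E) E)).charpoly ∈
      {p : (AdeleRing (𝓞 E) E)[X] |
        (∃ γ : (quasiSplit F E c N).arithmeticSubgroup,
          ((adelicVal F E c N _ (γ : (quasiSplit F E c N).Adelic) : GL (Fin N) (AdeleRing (𝓞 E) E)) :
            Matrix (Fin N) (Fin N) (AdeleRing (𝓞 E) E)).charpoly = p) ∧
        ∃ g ∈ C, ((adelicVal F E c N _ g : GL (Fin N) (AdeleRing (𝓞 E) E)) :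
            Matrix (Fin N) (Fin N) (AdeleRing (𝓞 E) E)).charpoly = p} := by
  have hy : y⁻¹ * (β : (quasiSplit F E c N).Adelic) * (u * y) =
      y⁻¹ * ((β : (quasiSplit F E c N).Adelic) * u) * y := by simp only [mul_assoc]
  refine ⟨⟨β, rfl⟩, _, h, ?_⟩
  rw [hy, charpoly_adelicVal_conj ((β : (quasiSplit F E c N).Adelic) * u) y,
    charpoly_adelicVal_mul_of_mem_borelAdelic_of_mem_adelicUnipotent ((mem_arithmeticBorel_iff β).1 hβ) hu]

end UnitaryGroup

end Literature.NumberTheory.Automorphic
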